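import Summits.ResolutionOfSingularities.ResolutionOfSingularities.Theorems.FrobeniusClosingPatchingRelPerfectConeDepthPointCharts
import Summits.ResolutionOfSingularities.ResolutionOfSingularities.Theorems.FrobeniusClosingPatchingRelPerfectConeDepthVertexFibre
import HarnessLib

/-!
# Crux `PatchingRelPerfect` (stmt-ResolutionOfSingularities-16161), chain W5.2 — rung «r-binary-disc-ℓ»: THE POINT FIBRE THEOREM
# (the foot of the line ladder) — blowing up a closed point through which the binary-form host `c₀² + b c₀c₁ + a c₁²` passes

[OURS · L1 W5.2 · rung tool] Replaces the role of NO printed item; NOT a statement of the manuscript under review; fact-free,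
any characteristic, any residue field.  AI-written (AI review is weaker than expert review).

Blow up a point `z` (`J_z = 𝔪_z`, `𝒪_{X,z}` regular of dimension four with regular system of parameters `c`) and follow the host
`𝓗_z = (c₀c₀ + b c₀c₁ + a c₁c₁)` (`b² − 4a` a unit) and the two planes `P₁_z = (c₀)`, `P₂_z = (c₁)`.  Over `z`:
* at a point of the NEW LINE `V(P₁') ∩ V(P₂')` (closed or not) the configuration of the LINE ladder appears: a part `(c'₀, c'₁, c'₂)`
  of a regular system of parameters with `E' = (c'₀)`, `P_k' = (c'_k)`, `𝓗' = (c'₁c'₁ + b' c'₁c'₂ + a' c'₂c'₂)` (`point_line`);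
* at every other point over `z` the host transform and the exceptional divisor have simple normal crossings (`point_snc`).
Assembled from `…PointCharts` through the chart cover of the fibre (`exists_charts_over`) exactly as the smooth-quadric fibre
theorem; `point_fibre` is the form used by the foot of the ladder.

## References
* J. Kollár, *Lectures on Resolution of Singularities* (2007), 3.61. [Kollar2007]
* The Stacks Project, Tags 0804, 0BIQ. [StacksProject]
-/

set_option linter.dupNamespace false

noncomputable section

open CategoryTheory CategoryTheory.Limits AlgebraicGeometry TopologicalSpace IsLocalRing
open Literature.AlgebraicGeometry.Resolution
open Scheme.IdealSheafData
open scoped Pointwise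

namespace Summit.ResolutionOfSingularities.ResolutionOfSingularities.Theorems

universe u

namespace ConeDepth

/-- **`φ(N(c₀,c₁)) = φ(c_j)² · f_j`**, `f_j = e₀e₀ + b e₀e₁ + a e₁e₁`, on the chart `j` of a point blowing up. [folklore] -/
theorem chartBase_binForm₄ {R : Type u} [CommRing R] (c : Fin 4 → R) (a b : R) (j : Fin 4) :
    chartBase c j (c 0 * c 0 + b * (c 0 * c 1) + a * (c 1 * c 1)) =
      chartBase c j (c j) ^ 2 * (chartGen c j 0 * chartGen c j 0 + chartBase c j b * (chartGen c j 0 * chartGen c j 1) +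
        chartBase c j a * (chartGen c j 1 * chartGen c j 1)) := by
  rw [map_add, map_add, map_mul, map_mul, map_mul, map_mul, map_mul, reesChartBase_apply_eq_mul_chartGen c j 0,
    reesChartBase_apply_eq_mul_chartGen c j 1]
  ring

/-- Converse of `mem_of_mem_support`: if the generator lies in the prime, the point lies on the support. [folklore] -/
theorem mem_support_of_mem {X' : Scheme.{u}} {A : Type u} [CommRing A] {x' : X'} (χ : A →+* X'.presheaf.stalk x')
    (𝔓 : Ideal A) [𝔓.IsPrime] (hloc : @IsLocalization.AtPrime _ _ (X'.presheaf.stalk x') _ χ.toAlgebra 𝔓 _)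
    {D : X'.IdealSheafData} {g : A} (hD : stalkIdeal D x' = Ideal.span {χ g}) (hg : g ∈ 𝔓) : x' ∈ D.support := by
  letI : Algebra A (X'.presheaf.stalk x') := χ.toAlgebra
  rw [mem_support_iff_stalkIdeal_ne_top, hD]
  intro htop
  have hu : IsUnit (χ g) := Ideal.span_singleton_eq_top.mp htop
  exact ((IsLocalization.AtPrime.isUnit_to_map_iff (X'.presheaf.stalk x') 𝔓 g).mp hu) hg

section PointFibre

variable {X' X : Scheme.{u}} {σ : X' ⟶ X} {J : X.IdealSheafData}
  (hσ : IsBlowup σ J) (z : X) (c : Fin 4 → X.presheaf.stalk z) [IsRegularLocalRing (X.presheaf.stalk z)]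
  (hz𝔪 : Ideal.span (Set.range c) = maximalIdeal (X.presheaf.stalk z))
  (hd : (maximalIdeal (X.presheaf.stalk z)).spanFinrank = 4)
  (hJ : stalkIdeal J z = maximalIdeal (X.presheaf.stalk z))
  (a b : X.presheaf.stalk z) (hD : IsUnit (b ^ 2 - 4 * a))
  (𝓗 P₁ P₂ : X.IdealSheafData)
  (h𝓗 : stalkIdeal 𝓗 z = Ideal.span {c 0 * c 0 + b * (c 0 * c 1) + a * (c 1 * c 1)})
  (hP₁ : stalkIdeal P₁ z = Ideal.span {c 0}) (hP₂ : stalkIdeal P₂ z = Ideal.span {c 1})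
  (q : (j : Fin 4) → (Spec (.of (chartRing c j)) ⟶ X'))
  (hqσ : ∀ j, q j ≫ σ = Spec.map (CommRingCat.ofHom (chartBase c j)) ≫ X.fromSpecStalk z)
  (hqiso : ∀ j (w' : Spec (.of (chartRing c j))), IsIso ((q j).stalkMap w'))

include hσ hz𝔪 hJ h𝓗 hP₁ hP₂ hqσ hqiso in
omit [IsRegularLocalRing (X.presheaf.stalk z)] in
/-- **Presentation of a point of the fibre on chart `j`** with the four stalks of interest: exceptional divisor `(φ c_j)`, host
transform `(f_j)`, planes `(e₀)`, `(e₁)`. [cite: StacksProject, Tag 0804] -/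
theorem point_presentation (j : Fin 4) (w' : PrimeSpectrum (chartRing c j)) (x' : X') (hx' : q j w' = x') (hz' : σ x' = z) :
    ∃ χ : chartRing c j →+* X'.presheaf.stalk x',
      @IsLocalization.AtPrime _ _ (X'.presheaf.stalk x') _ χ.toAlgebra w'.asIdeal _ ∧
      w'.asIdeal.comap (chartBase c j) = maximalIdeal (X.presheaf.stalk z) ∧
      stalkIdeal (J.comap σ) x' = Ideal.span {χ (chartBase c j (c j))} ∧
      stalkIdeal (controlledTransform σ J 𝓗 2) x' = Ideal.span {χ (chartGen c j 0 * chartGen c j 0 +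
        chartBase c j b * (chartGen c j 0 * chartGen c j 1) + chartBase c j a * (chartGen c j 1 * chartGen c j 1))} ∧
      stalkIdeal (controlledTransform σ J P₁ 1) x' = Ideal.span {χ (chartGen c j 0)} ∧
      stalkIdeal (controlledTransform σ J P₂ 1) x' = Ideal.span {χ (chartGen c j 1)} := by
  classical
  have hc := span_eq_stalkIdeal_centre z c hz𝔪 hJ
  haveI := hqiso j w'
  obtain ⟨χ, hχ, hloc, hw𝔪⟩ := exists_stalk_presentation c j (q j) (hqσ j) w' hx' hz'
  letI : Algebra (chartRing c j) (X'.presheaf.stalk x') := χ.toAlgebra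
  haveI := hloc
  have hnzd : χ (chartBase c j (c j)) ∈ nonZeroDivisors (X'.presheaf.stalk x') :=
    algebraMap_centre_mem_nonZeroDivisors c j (X'.presheaf.stalk x') (chartBase c j)
      (reesChartBase_mem_nonZeroDivisors (c j) (Ideal.mem_span_range_self (f := c) (x := j))) w'.asIdeal
  refine ⟨χ, hloc, hw𝔪, stalkIdeal_exceptional_of_presentation χ hz' hχ hc, ?_, ?_, ?_⟩
  · exact stalkIdeal_controlledTransform_of_presentation χ hz' hχ hσ hc hnzd 𝓗 _ h𝓗 2 _
      (by rw [chartBase_binForm₄ c a b j, map_mul, map_pow])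
  · exact stalkIdeal_controlledTransform_of_presentation χ hz' hχ hσ hc hnzd P₁ _ hP₁ 1 (chartGen c j 0)
      (by rw [reesChartBase_apply_eq_mul_chartGen c j 0, map_mul, pow_one])
  · exact stalkIdeal_controlledTransform_of_presentation χ hz' hχ hσ hc hnzd P₂ _ hP₂ 1 (chartGen c j 1)
      (by rw [reesChartBase_apply_eq_mul_chartGen c j 1, map_mul, pow_one])

include hσ hz𝔪 hd hJ hD h𝓗 hP₁ hP₂ hqσ hqiso in
/-- **A point of the NEW LINE** (both plane transforms pass through it; any prime, e.g. the generic point of the line): a part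
`(c'₀, c'₁, c'₂) = (φ c_j, e₀, e₁)` of a regular system of parameters reads `E', P₁', P₂'`, and the host transform is the binary form
`c'₁c'₁ + b c'₁c'₂ + a c'₂c'₂` — the shape of the LINE ladder. [cite: StacksProject, Tag 0BIQ] -/
theorem point_line (j : Fin 4) (w' : PrimeSpectrum (chartRing c j)) (x' : X') (hx' : q j w' = x') (hz' : σ x' = z)
    (hx1 : x' ∈ (controlledTransform σ J P₁ 1).support) (hx2 : x' ∈ (controlledTransform σ J P₂ 1).support) :
    ∃ c' : Fin 3 → X'.presheaf.stalk x', IsRsopPart c' ∧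
      stalkIdeal (J.comap σ) x' = Ideal.span {c' 0} ∧
      stalkIdeal (controlledTransform σ J P₁ 1) x' = Ideal.span {c' 1} ∧
      stalkIdeal (controlledTransform σ J P₂ 1) x' = Ideal.span {c' 2} ∧
      ∃ a' b' : X'.presheaf.stalk x', IsUnit (b' ^ 2 - 4 * a') ∧
        stalkIdeal (controlledTransform σ J 𝓗 2) x' = Ideal.span {c' 1 * c' 1 + b' * (c' 1 * c' 2) + a' * (c' 2 * c' 2)} := by
  classical
  obtain ⟨χ, hloc, hw𝔪, hE, hH, hP1, hP2⟩ := point_presentation hσ z c hz𝔪 hJ a b 𝓗 P₁ P₂ h𝓗 hP₁ hP₂ q hqσ hqiso j w' x' hx' hz'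
  letI : Algebra (chartRing c j) (X'.presheaf.stalk x') := χ.toAlgebra
  haveI := hloc
  have h0 : chartGen c j 0 ∈ w'.asIdeal := mem_of_mem_support χ w'.asIdeal hloc hP1 hx1
  have h1 : chartGen c j 1 ∈ w'.asIdeal := mem_of_mem_support χ w'.asIdeal hloc hP2 hx2
  have hj0 : (0 : Fin 4) ≠ j := by
    rintro rfl
    rw [show chartGen c 0 0 = 1 from chartGen_self c 0] at h0
    exact w'.isPrime.ne_top ((Ideal.eq_top_iff_one _).mpr h0)
  have hj1 : (1 : Fin 4) ≠ j := by
    rintro rfl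
    rw [show chartGen c 1 1 = 1 from chartGen_self c 1] at h1
    exact w'.isPrime.ne_top ((Ideal.eq_top_iff_one _).mpr h1)
  obtain ⟨hv, hv0, hv1, hv2⟩ := pointLine c hz𝔪 hd j w'.asIdeal hw𝔪 (X'.presheaf.stalk x') hj0 hj1 h0 h1
  set v := chartFamily c j (Fin.elim0 : Fin 0 → X.presheaf.stalk z) (X'.presheaf.stalk x') (chartBase c j) (chartGen c j)
    (![⟨0, hj0⟩, ⟨1, hj1⟩] : Fin 2 → {k : Fin 4 // k ≠ j}) with hvdef
  have hι : Function.Injective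
      (![0, Fin.succ (Fin.castAdd 0 0), Fin.succ (Fin.castAdd 0 1)] : Fin 3 → Fin (2 + 0 + 1)) := by decide
  refine ⟨v ∘ (![0, Fin.succ (Fin.castAdd 0 0), Fin.succ (Fin.castAdd 0 1)] : Fin 3 → Fin (2 + 0 + 1)), hv.comp _ hι,
    ?_, ?_, ?_, χ (chartBase c j a), χ (chartBase c j b), ?_, ?_⟩
  · rw [hE]
    exact congrArg _ (congrArg _ hv0.symm)
  · rw [hP1]
    exact congrArg _ (congrArg _ hv1.symm)
  · rw [hP2]
    exact congrArg _ (congrArg _ hv2.symm)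
  · have h := hD.map (χ.comp (chartBase c j))
    simpa only [map_sub, map_pow, map_mul, map_ofNat, RingHom.comp_apply] using h
  · have e1 : (v ∘ (![0, Fin.succ (Fin.castAdd 0 0), Fin.succ (Fin.castAdd 0 1)] : Fin 3 → Fin (2 + 0 + 1))) 1 =
        χ (chartGen c j 0) := hv1
    have e2 : (v ∘ (![0, Fin.succ (Fin.castAdd 0 0), Fin.succ (Fin.castAdd 0 1)] : Fin 3 → Fin (2 + 0 + 1))) 2 =
        χ (chartGen c j 1) := hv2
    refine hH.trans ?_
    simp only [e1, e2, map_add, map_mul]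

include hσ hz𝔪 hd hJ hD h𝓗 hP₁ hP₂ hqσ hqiso in
/-- **A point over `z` OFF the new line**: the host transform and the exceptional divisor have simple normal crossings (charts
`0, 1`: the reduced chart polynomial is smooth, `smoothQuadChart`; charts `2, 3`: `pointChart_far`). [cite: Kollar2007, Def. 3.24] -/
theorem point_snc (j : Fin 4) (w' : PrimeSpectrum (chartRing c j)) (x' : X') (hx' : q j w' = x') (hz' : σ x' = z)
    (hnl : ¬ (x' ∈ (controlledTransform σ J P₁ 1).support ∧ x' ∈ (controlledTransform σ J P₂ 1).support)) :
    DepthSNC.SNCWithAt [controlledTransform σ J 𝓗 2, J.comap σ] ⊤ x' := by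
  classical
  obtain ⟨χ, hloc, hw𝔪, hE, hH, hP1, hP2⟩ := point_presentation hσ z c hz𝔪 hJ a b 𝓗 P₁ P₂ h𝓗 hP₁ hP₂ q hqσ hqiso j w' x' hx' hz'
  letI : Algebra (chartRing c j) (X'.presheaf.stalk x') := χ.toAlgebra
  haveI := hloc
  have hD' : IsUnit (b * b - (a + a + (a + a))) := by
    have h : b * b - (a + a + (a + a)) = b ^ 2 - 4 * a := by ring
    rw [h]; exact hD
  have hne : chartGen c j 0 * chartGen c j 0 + chartBase c j b * (chartGen c j 0 * chartGen c j 1) +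
      chartBase c j a * (chartGen c j 1 * chartGen c j 1) ≠ chartBase c j (c j) := by
    have h := chartForm_ne_chartBase _ c hz𝔪 hd j (chartPoly_binForm_ne_zero a b hD j)
    rwa [chartForm_binForm] at h
  have had : ∃ (n : ℕ) (v : Fin n → X'.presheaf.stalk x')
      (ι : {g : chartRing c j // g ∈ [chartBase c j (c j), chartGen c j 0 * chartGen c j 0 +
        chartBase c j b * (chartGen c j 0 * chartGen c j 1) + chartBase c j a * (chartGen c j 1 * chartGen c j 1)] ∧
          g ∈ w'.asIdeal} → Fin n),
      IsRsopPart v ∧ Function.Injective ι ∧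
        ∀ g, v (ι g) = (algebraMap (chartRing c j) (X'.presheaf.stalk x') : chartRing c j →+* X'.presheaf.stalk x') g.1 := by
    by_cases hj0 : (0 : Fin 4) = j
    · subst hj0
      have h := smoothQuadChart _ c hz𝔪 hd 0 w'.asIdeal hw𝔪 (X'.presheaf.stalk x') (binForm_smooth_zero a b hD)
      rwa [chartForm_binForm] at h
    by_cases hj1 : (1 : Fin 4) = j
    · subst hj1
      have h := smoothQuadChart _ c hz𝔪 hd 1 w'.asIdeal hw𝔪 (X'.presheaf.stalk x') (binForm_smooth_one a b hD)
      rwa [chartForm_binForm] at h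
    have hnl' : ¬ (chartGen c j 0 ∈ w'.asIdeal ∧ chartGen c j 1 ∈ w'.asIdeal) := by
      rintro ⟨g0, g1⟩
      exact hnl ⟨mem_support_of_mem χ w'.asIdeal hloc hP1 g0, mem_support_of_mem χ w'.asIdeal hloc hP2 g1⟩
    exact pointChart_far c hz𝔪 hd a b j w'.asIdeal hw𝔪 (X'.presheaf.stalk x') hj0 hj1 hD' hnl'
  have key : DepthSNC.SNCWithAt ([(J.comap σ, chartBase c j (c j)), (controlledTransform σ J 𝓗 2,
      chartGen c j 0 * chartGen c j 0 + chartBase c j b * (chartGen c j 0 * chartGen c j 1) +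
        chartBase c j a * (chartGen c j 1 * chartGen c j 1))].map Prod.fst) ⊤ x' := by
    refine sncWithAt_of_adapted χ w'.asIdeal hloc _ ?_ ?_ had
    · intro p hp
      simp only [List.mem_cons, List.not_mem_nil, or_false] at hp
      rcases hp with rfl | rfl
      · exact hE
      · exact hH
    · intro p hp p' hp' h
      simp only [List.mem_cons, List.not_mem_nil, or_false] at hp hp'
      rcases hp with rfl | rfl <;> rcases hp' with rfl | rfl
      · rfl
      · exact absurd h.symm hne
      · exact absurd h hne
      · rfl
  refine key.anti fun D hD'' _ => ?_
  simp only [List.mem_cons, List.not_mem_nil, or_false] at hD''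
  simp only [List.map_cons, List.map_nil, List.mem_cons, List.not_mem_nil, or_false]
  rcases hD'' with rfl | rfl
  · exact Or.inr rfl
  · exact Or.inl rfl

end PointFibre

/-- **THE POINT FIBRE THEOREM (foot of the line ladder).**  Blow up a point `z` (`J_z = 𝔪_z`, `𝒪_{X,z}` regular of dimension four,
regular system of parameters `c`) and follow the host `𝓗_z = (c₀c₀ + b c₀c₁ + a c₁c₁)` (`b² − 4a` a unit) and the planes
`P₁_z = (c₀)`, `P₂_z = (c₁)`: at a point over `z` on both plane transforms, a part `(c'₀, c'₁, c'₂)` of a regular system of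
parameters reads `E' = (c'₀)`, `P_k' = (c'_k)` and `𝓗' = (c'₁c'₁ + b' c'₁c'₂ + a' c'₂c'₂)` with `b'² − 4a'` a unit; at every other
point over `z`, `[𝓗', E']` has simple normal crossings. [cite: Kollar2007, 3.61] [cite: StacksProject, Tag 0804] -/
theorem point_fibre {X' X : Scheme.{u}} {σ : X' ⟶ X} {J : X.IdealSheafData} (hσ : IsBlowup σ J) (z : X)
    (c : Fin 4 → X.presheaf.stalk z) [IsRegularLocalRing (X.presheaf.stalk z)]
    (hz𝔪 : Ideal.span (Set.range c) = maximalIdeal (X.presheaf.stalk z))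
    (hd : (maximalIdeal (X.presheaf.stalk z)).spanFinrank = 4) (hJ : stalkIdeal J z = maximalIdeal (X.presheaf.stalk z))
    (a b : X.presheaf.stalk z) (hD : IsUnit (b ^ 2 - 4 * a)) (𝓗 P₁ P₂ : X.IdealSheafData)
    (h𝓗 : stalkIdeal 𝓗 z = Ideal.span {c 0 * c 0 + b * (c 0 * c 1) + a * (c 1 * c 1)})
    (hP₁ : stalkIdeal P₁ z = Ideal.span {c 0}) (hP₂ : stalkIdeal P₂ z = Ideal.span {c 1}) :
    ∀ x' : X', σ x' = z →
      (x' ∈ (controlledTransform σ J P₁ 1).support → x' ∈ (controlledTransform σ J P₂ 1).support →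
        ∃ c' : Fin 3 → X'.presheaf.stalk x', IsRsopPart c' ∧
          stalkIdeal (J.comap σ) x' = Ideal.span {c' 0} ∧
          stalkIdeal (controlledTransform σ J P₁ 1) x' = Ideal.span {c' 1} ∧
          stalkIdeal (controlledTransform σ J P₂ 1) x' = Ideal.span {c' 2} ∧
          ∃ a' b' : X'.presheaf.stalk x', IsUnit (b' ^ 2 - 4 * a') ∧
            stalkIdeal (controlledTransform σ J 𝓗 2) x' =
              Ideal.span {c' 1 * c' 1 + b' * (c' 1 * c' 2) + a' * (c' 2 * c' 2)}) ∧
      (¬ (x' ∈ (controlledTransform σ J P₁ 1).support ∧ x' ∈ (controlledTransform σ J P₂ 1).support) →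
        DepthSNC.SNCWithAt [controlledTransform σ J 𝓗 2, J.comap σ] ⊤ x') := by
  classical
  obtain ⟨q, hqσ, hqiso, hcov⟩ := exists_charts_over hσ z c (span_eq_stalkIdeal_centre z c hz𝔪 hJ)
  intro x' hx'
  obtain ⟨j, w', hqw⟩ := hcov x' hx'
  exact ⟨fun h1 h2 => point_line hσ z c hz𝔪 hd hJ a b hD 𝓗 P₁ P₂ h𝓗 hP₁ hP₂ q hqσ hqiso j w' x' hqw hx' h1 h2,
    fun hnl => point_snc hσ z c hz𝔪 hd hJ a b hD 𝓗 P₁ P₂ h𝓗 hP₁ hP₂ q hqσ hqiso j w' x' hqw hx' hnl⟩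

end ConeDepth

end Summit.ResolutionOfSingularities.ResolutionOfSingularities.Theorems

end
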